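import Summits.Schanuel.Schanuel.Theorems.RootDecomp1KRadical05

/-!
# RootDecomp1KRadical («RADICAL CELLS», lens 6 gen 11) — continuation (RootDecomp1KRadicalCells): §25 THE RADICAL CELLS of A₄ʰ 33363 (hyperCell_radical_any, hyperLiouvilleSchanuel_live_at_radicalCell) + §25a Lindemann cells (mod hW) + §25b π-POWER CELLS — UNCONDITIONAL: algebraicIndependent_pi_rpow ((ρ, π, π^ρ) a.i.), hyperCell_logPi_any, hyperLiouvilleSchanuel_live_at_logPiCell + §25c fixed-point cells (mod hNW)

Part of the six-file split (400-line rule) of lens 6's gen-11 node «RADICAL CELLS» = HOME/decomp-schanuel-lens-6/g11/addendum/RadicalCells.lean (sha256 16cddffc…, 2182 l;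
1K ROUND 8 THEOREM ROUND, PATH T; critic VERDICT 2026-08-30T18:23:36Z ACCEPTED; census C-7bis; `--supports stmt-Schanuel-33363`). Port hygiene: the node's COPY blocks of §19/§21/§22
declarations are NOT re-declared — they are the landed ones of Theorems/RootDecomp1KDark*/Torsion*/Kummer* (opened by name); twins of private/foreign tree lemmas are private here.
All parts share the namespace `Summit.Schanuel.Schanuel.Theorems.RootDecomp1KRadical`; the node docstring is in part 01. Sorry-free; standard axioms. Nothing here proves Schanuel; rung 0.
-/

noncomputable section

open Complex IntermediateField Polynomial

namespace Summit.Schanuel.Schanuel.Theorems.RootDecomp1KRadical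

open Summit.Schanuel.Schanuel.Theorems.RootDecomp1KHyper (len len_nonneg one_le_len abs_coeff_le_len)
open Summit.Schanuel.Schanuel.Theorems.RootDecomp1KHyper.HyperCell (norm_aeval_le_len_mul_pow conjFactor sliceAt
  relHat resPoly eval_conjFactor eval_sliceAt natDegree_conjFactor_le coeff_conjFactor natDegree_sliceAt_le
  natDegree_relHat_le evC evC_apply evC_comp_C map_relHat_evC relLen relLen_nonneg eval_map_int
  isAlgebraic_of_aeval_int norm_multiset_map_prod_le multiset_map_prod_le torCo torG aeval_torG natDegree_torG_le
  coeff_torG torCo_cast_eq eval_conjFactor_torG torD coeff_torD torD_ne_zero coeff_torG_eq_torD denBound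
  den_lt_denBound norm_mvaeval_le cP cP_nonneg one_le_cP abs_torCo_le abs_coeff_torG_le len_torG_le relLen_torG_le
  pow_le_exp_mul eta_lt_delta upper_exp algebraicIndependent_of_forall_int HyperLiouville.rat_mul
  dvd_of_irreducible_of_common_root pair_bounds HyperLiouville.ne_ratCast HyperLiouville.ne_zero HyperLiouville.neg)

variable {K : ℕ}

open Summit.Schanuel.Schanuel.Theorems.RootDecomp1KHyper.HyperCell (HyperLiouville)
open Summit.Schanuel.Schanuel.Theorems.RootDecomp1KHyper (WMeasure SB SFset sb_of_algebraicIndependent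
  mem_adjoin_SFset_I')

/-! ## 25. THE RADICAL CELLS of A₄ʰ at every anchor `u` with `e^u` of finite transcendence type -/

/-- `SB N z` (`N ≤ 3`) as soon as `ℚ(z, e^z, i)` contains `ρ', y, e^{uρ'}` for a hyper-Liouville
`ρ' > 0` and `y = e^u` of finite transcendence type. -/
theorem sb_radical_of_mem {u y : ℂ} (huy : cexp u = y) (hy : FiniteTranscendenceType y)
    {ρ' : ℝ} (hρ' : HyperLiouville ρ') (hρ'0 : 0 < ρ')
    {N : ℕ} (hN : N ≤ 3) {z : Fin N → ℂ} (h0 : (ρ' : ℂ) ∈ adjoin ℚ (SFset z ∪ {I}))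
    (h1 : y ∈ adjoin ℚ (SFset z ∪ {I}))
    (h2 : cexp (u * (ρ' : ℂ)) ∈ adjoin ℚ (SFset z ∪ {I})) : SB N z := by
  refine sb_of_algebraicIndependent (algebraicIndependent_radical huy hy hρ' hρ'0)
    (by simpa using hN) fun j => ?_
  fin_cases j
  · exact h0
  · exact h1
  · exact h2

/-- **RADICAL CELLS (kernel).**  `u ≠ 0` with `e^u` of finite transcendence type, `ρ` hyper-Liouville
(either sign), ANY `w ∈ ℂ`: the pair `(u, ρu)` and the triple `(u, ρu, w)` satisfy Schanuel's bound
`SB 2`, `SB 3` — via the triple `(ρ', e^u, e^{uρ'})`, `ρ' = ±ρ > 0`: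
`ℚ(z, e^z, i) ∋ ρ' = ±z₁/z₀`, `e^u = e^{z₀}`, `e^{uρ'} = (e^{z₁})^{±1}`. -/
theorem hyperCell_radical_any {u : ℂ} (hu0 : u ≠ 0) (hy : FiniteTranscendenceType (cexp u))
    {ρ : ℝ} (hρ : HyperLiouville ρ) (w : ℂ) :
    SB 2 ![u, (ρ : ℂ) * u] ∧ SB 3 ![u, (ρ : ℂ) * u, w] := by
  have hρ0 : ρ ≠ 0 := HyperLiouville.ne_zero hρ
  -- the sign `ε = ±1` with `ρ' = ερ > 0`
  obtain ⟨ε, hε1, hpos⟩ : ∃ ε : ℝ, (ε = 1 ∨ ε = -1) ∧ 0 < ε * ρ := by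
    rcases lt_or_gt_of_ne hρ0 with h | h
    · exact ⟨-1, Or.inr rfl, by nlinarith⟩
    · exact ⟨1, Or.inl rfl, by linarith⟩
  have hρ' : HyperLiouville (ε * ρ) := by
    rcases hε1 with rfl | rfl
    · rw [one_mul]; exact hρ
    · rw [neg_one_mul]; exact HyperLiouville.neg hρ
  have key : ∀ F : IntermediateField ℚ ℂ, u ∈ F → (ρ : ℂ) * u ∈ F → cexp ((ρ : ℂ) * u) ∈ F →
      cexp u ∈ F →
      (((ε * ρ : ℝ)) : ℂ) ∈ F ∧ cexp u ∈ F ∧ cexp (u * (((ε * ρ : ℝ)) : ℂ)) ∈ F := by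
    intro F hz0 hz1 he1 he0
    have hρmem : (ρ : ℂ) ∈ F := by
      have hdiv := div_mem hz1 hz0
      rwa [mul_div_assoc, div_self hu0, mul_one] at hdiv
    refine ⟨?_, he0, ?_⟩
    · rcases hε1 with rfl | rfl
      · push_cast; rw [one_mul]; exact hρmem
      · push_cast; rw [neg_one_mul]; exact neg_mem hρmem
    · rcases hε1 with rfl | rfl
      · have e : cexp (u * (((1 * ρ : ℝ)) : ℂ)) = cexp ((ρ : ℂ) * u) := by
          congr 1; push_cast; ring
        rw [e]; exact he1
      · have e : cexp (u * (((-1 * ρ : ℝ)) : ℂ)) = (cexp ((ρ : ℂ) * u))⁻¹ := by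
          rw [← Complex.exp_neg]; congr 1; push_cast; ring
        rw [e]; exact inv_mem he1
  refine ⟨?_, ?_⟩
  · obtain ⟨h0, h1, h2⟩ := key (adjoin ℚ (SFset ![u, (ρ : ℂ) * u] ∪ {I}))
      (mem_adjoin_SFset_I' (Or.inl ⟨0, rfl⟩)) (mem_adjoin_SFset_I' (Or.inl ⟨1, rfl⟩))
      (mem_adjoin_SFset_I' (Or.inr ⟨1, rfl⟩)) (mem_adjoin_SFset_I' (Or.inr ⟨0, rfl⟩))
    exact sb_radical_of_mem rfl hy hρ' hpos (by omega) h0 h1 h2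
  · obtain ⟨h0, h1, h2⟩ := key (adjoin ℚ (SFset ![u, (ρ : ℂ) * u, w] ∪ {I}))
      (mem_adjoin_SFset_I' (Or.inl ⟨0, rfl⟩)) (mem_adjoin_SFset_I' (Or.inl ⟨1, rfl⟩))
      (mem_adjoin_SFset_I' (Or.inr ⟨1, rfl⟩)) (mem_adjoin_SFset_I' (Or.inr ⟨0, rfl⟩))
    exact sb_radical_of_mem rfl hy hρ' hpos le_rfl h0 h1 h2

/-- Live-text form (the body of A₄ʰ = `HyperLiouvilleSchanuel`, item 33363, at `n = 3`) at the radical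
cells — both hypotheses of A₄ʰ idle. -/
theorem hyperLiouvilleSchanuel_live_at_radicalCell {u : ℂ} (hu0 : u ≠ 0)
    (hy : FiniteTranscendenceType (cexp u)) {ρ : ℝ} (hρ : HyperLiouville ρ) (w : ℂ) :
    LinearIndependent ℚ ![u, (ρ : ℂ) * u, w] →
    (∀ m : ℕ, ∃ h : Fin 3 → ℤ, h ≠ 0 ∧
      ‖∑ i, (h i : ℂ) * ![u, (ρ : ℂ) * u, w] i‖ < Real.exp (-((1 + ∑ i, (|h i| : ℝ)) ^ m))) →
    ((3 : ℕ) : Cardinal) ≤ Algebra.trdeg ℚ ↥(IntermediateField.adjoin ℚ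
      (Set.range ![u, (ρ : ℂ) * u, w] ∪ Set.range (Complex.exp ∘ ![u, (ρ : ℂ) * u, w]))) :=
  fun _ _ => (hyperCell_radical_any hu0 hy hρ w).2

/-! ### 25a. LINDEMANN CELLS: anchors `β ∈ ℚ̄^×` (mod W78 Cor. 3.9 = `WMeasure`, PROVED in the tree) -/

/-- **Lindemann extraction**: `ρ, e^β, e^{βρ}` algebraically independent (`β ≠ 0` algebraic,
`ρ > 0` hyper-Liouville; mod W78 Cor. 3.9). -/
theorem algebraicIndependent_lindemann (hW : WMeasure) {β : ℂ} (hβ : IsAlgebraic ℚ β) (hβ0 : β ≠ 0)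
    {ρ : ℝ} (hρ : HyperLiouville ρ) (hρ0 : 0 < ρ) :
    AlgebraicIndependent ℚ ![(ρ : ℂ), cexp β, cexp (β * (ρ : ℂ))] :=
  algebraicIndependent_radical rfl (finiteTranscendenceType_exp_of_W hW hβ hβ0) hρ hρ0

/-- **LINDEMANN CELLS** at every anchor `β ∈ ℚ̄^×`: `SB 2 (β, ρβ)`, `SB 3 (β, ρβ, w)` for every
hyper-Liouville `ρ` and every `w`.  (The rational anchors `β ∈ ℚ^×` were decided in g9 §17
(`algebraicIndependent_three_of_hyperLiouville`, mod `ExplicitRatExpApprox`); the IRRATIONAL algebraic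
anchors — e.g. `β = √2`, `β = i` (the imaginary axis) — are new.) -/
theorem hyperCell_lindemann_any (hW : WMeasure) {β : ℂ} (hβ : IsAlgebraic ℚ β) (hβ0 : β ≠ 0)
    {ρ : ℝ} (hρ : HyperLiouville ρ) (w : ℂ) :
    SB 2 ![β, (ρ : ℂ) * β] ∧ SB 3 ![β, (ρ : ℂ) * β, w] :=
  hyperCell_radical_any hβ0 (finiteTranscendenceType_exp_of_W hW hβ hβ0) hρ w

/-- the cells on the imaginary axis: anchor `β = i` -/
theorem hyperCell_I_any (hW : WMeasure) {ρ : ℝ} (hρ : HyperLiouville ρ) (w : ℂ) :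
    SB 2 ![I, (ρ : ℂ) * I] ∧ SB 3 ![I, (ρ : ℂ) * I, w] :=
  hyperCell_lindemann_any hW ⟨X ^ 2 + 1, by
    refine fun h => ?_
    have := congrArg (fun p : ℚ[X] => p.coeff 0) h
    simp at this, by simp⟩ I_ne_zero hρ w

/-! ### 25b. π-POWER CELLS: anchors `u` with `e^u = π` — UNCONDITIONAL (NW96 Thm 2(2) is PROVED in the tree) -/

/-- `cexp (log π) = π` -/
private theorem cexp_log_pi : cexp (((Real.log Real.pi : ℝ)) : ℂ) = (Real.pi : ℂ) := by
  rw [← Complex.ofReal_exp, Real.exp_log Real.pi_pos]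

/-- **(ρ, π, π^ρ) are algebraically independent over `ℚ`** for every hyper-Liouville real `ρ > 0` —
UNCONDITIONALLY (kernel-checked from the tree's proved transcendence measure of `π`). -/
theorem algebraicIndependent_pi_rpow {ρ : ℝ} (hρ : HyperLiouville ρ) (hρ0 : 0 < ρ) :
    AlgebraicIndependent ℚ ![(ρ : ℂ), (Real.pi : ℂ), (((Real.pi ^ ρ : ℝ)) : ℂ)] := by
  have h := algebraicIndependent_radical cexp_log_pi finiteTranscendenceType_pi hρ hρ0
  have e : cexp ((((Real.log Real.pi : ℝ)) : ℂ) * (ρ : ℂ)) = (((Real.pi ^ ρ : ℝ)) : ℂ) := by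
    rw [← Complex.ofReal_mul, ← Complex.ofReal_exp, Real.rpow_def_of_pos Real.pi_pos]
  rwa [e] at h

/-- **π-POWER CELLS**: for every `u` with `e^u = π` (all determinations of `log π`), every hyper-Liouville
`ρ` and every `w`: `SB 2 (u, ρu)` and `SB 3 (u, ρu, w)` — UNCONDITIONAL.  The anchor `u = log π` is
DARK in the strongest sense: not even the irrationality of `log π` is known. -/
theorem hyperCell_logPi_any {u : ℂ} (hu : cexp u = (Real.pi : ℂ)) {ρ : ℝ} (hρ : HyperLiouville ρ)
    (w : ℂ) : SB 2 ![u, (ρ : ℂ) * u] ∧ SB 3 ![u, (ρ : ℂ) * u, w] := by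
  have hu0 : u ≠ 0 := by
    intro h0
    rw [h0, Complex.exp_zero] at hu
    have h1 : (1 : ℝ) = Real.pi := by exact_mod_cast hu
    have := Real.pi_gt_three
    linarith
  exact hyperCell_radical_any hu0 (hu ▸ finiteTranscendenceType_pi) hρ w

/-- Live-text form of A₄ʰ (`n = 3`) at the π-power cells — UNCONDITIONAL. -/
theorem hyperLiouvilleSchanuel_live_at_logPiCell {u : ℂ} (hu : cexp u = (Real.pi : ℂ)) {ρ : ℝ}
    (hρ : HyperLiouville ρ) (w : ℂ) :
    LinearIndependent ℚ ![u, (ρ : ℂ) * u, w] →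
    (∀ m : ℕ, ∃ h : Fin 3 → ℤ, h ≠ 0 ∧
      ‖∑ i, (h i : ℂ) * ![u, (ρ : ℂ) * u, w] i‖ < Real.exp (-((1 + ∑ i, (|h i| : ℝ)) ^ m))) →
    ((3 : ℕ) : Cardinal) ≤ Algebra.trdeg ℚ ↥(IntermediateField.adjoin ℚ
      (Set.range ![u, (ρ : ℂ) * u, w] ∪ Set.range (Complex.exp ∘ ![u, (ρ : ℂ) * u, w]))) :=
  fun _ _ => (hyperCell_logPi_any hu hρ w).2

/-! ### 25c. FIXED-POINT CELLS: anchors `t` with `e^t = t` (mod NW96 Thm 1, registered fact) -/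

section FixCells
open Literature.NumberTheory.Transcendental

/-- **(ρ, t, e^{tρ}) are algebraically independent** for a fixed point `t` of `exp` and a hyper-Liouville
`ρ > 0` (mod NW96 Thm 1) — although `t` and `e^t` are algebraically DEPENDENT. -/
theorem algebraicIndependent_fixpoint (hNW : NesterenkoWaldschmidt1996_thm_1) {t : ℂ}
    (ht : cexp t = t) {ρ : ℝ} (hρ : HyperLiouville ρ) (hρ0 : 0 < ρ) :
    AlgebraicIndependent ℚ ![(ρ : ℂ), t, cexp (t * (ρ : ℂ))] :=
  algebraicIndependent_radical ht (finiteTranscendenceType_fixpoint hNW ht) hρ hρ0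

/-- **FIXED-POINT CELLS**: `e^t = t`, `ρ` hyper-Liouville, any `w`: `SB 2 (t, ρt)`, `SB 3 (t, ρt, w)`
(mod NW96 Thm 1).  Here Schanuel's bound for the pair `(t, e^t)` is TIGHT (`trdeg = 1`): the cell needs
the full contribution of `ρ` and `e^{ρt}`. -/
theorem hyperCell_fixpoint_any (hNW : NesterenkoWaldschmidt1996_thm_1) {t : ℂ} (ht : cexp t = t)
    {ρ : ℝ} (hρ : HyperLiouville ρ) (w : ℂ) :
    SB 2 ![t, (ρ : ℂ) * t] ∧ SB 3 ![t, (ρ : ℂ) * t, w] :=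
  hyperCell_radical_any (ne_zero_of_exp_eq_self ht)
    (by rw [ht]; exact finiteTranscendenceType_fixpoint hNW ht) hρ w

/-- Live-text form of A₄ʰ (`n = 3`) at the fixed-point cells (mod NW96 Thm 1). -/
theorem hyperLiouvilleSchanuel_live_at_fixpointCell (hNW : NesterenkoWaldschmidt1996_thm_1) {t : ℂ}
    (ht : cexp t = t) {ρ : ℝ} (hρ : HyperLiouville ρ) (w : ℂ) :
    LinearIndependent ℚ ![t, (ρ : ℂ) * t, w] →
    (∀ m : ℕ, ∃ h : Fin 3 → ℤ, h ≠ 0 ∧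
      ‖∑ i, (h i : ℂ) * ![t, (ρ : ℂ) * t, w] i‖ < Real.exp (-((1 + ∑ i, (|h i| : ℝ)) ^ m))) →
    ((3 : ℕ) : Cardinal) ≤ Algebra.trdeg ℚ ↥(IntermediateField.adjoin ℚ
      (Set.range ![t, (ρ : ℂ) * t, w] ∪ Set.range (Complex.exp ∘ ![t, (ρ : ℂ) * t, w]))) :=
  fun _ _ => (hyperCell_fixpoint_any hNW ht hρ w).2

end FixCells

end Summit.Schanuel.Schanuel.Theorems.RootDecomp1KRadical
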